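import Summits.CriticalPhenomena.PercolationContinuityZ3.Theorems.SahiMasterFamilyDenseEndSplits
import Summits.CriticalPhenomena.PercolationContinuityZ3.Theorems.SahiMasterFamilySparseEndTheorem
import Mathlib.Combinatorics.Enumerative.InclusionExclusion

/-!
# The dense end of Sahi's hierarchy, V: THE SIGN — `Ê(0) = (k−2)! · Σ_c w^c (1 − N(c)) ≥ 0` (Theorem D, all orders)

Support file of the master-family programme (crux `NoHeavyLowerTail`, stmt-CriticalPhenomena-4575; cell `prim-masterthm`, seat P4,
unit `prim-masterthm-p4-g5`).  Seat document HOME/prim-masterthm-p4/CORNERS.md §1, steps (c)–(d) of Theorem D.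

With `SahiMasterFamilyDenseEndFactor` (`E_k(μ_{1−q·w}; 1_U) = q^{m₂} Ê(q)`, `denseE_zero_eq`), the general-arity evaluation
`sparseE'_zero_eq` (`Ẽ_S(0) = Σ_{c} w^c Λ'`), the trace lemmas of `…DenseEndTraces` and the one-split lemma of `…DenseEndSplits`, this
file regroups `Ê(0)` by the cheapest double-failure configurations `c` and evaluates each group:

* `brCoeff_mul_factorial`, `sum_powerset_neg_one_pow_mul_card_sub_one` — the arithmetic
  (`brCoeff(s, k−s)·(s−1)! = (k−2)!·(s−1)`, `Σ_{S ⊆ T, |S| ≥ 2} (−1)^{|S|}(|S|−1) = 1`);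
* `phi_eq` — for each such `c`: `Σ_{S ⊆ T(c), |S| ≥ 2} (−1)^{|S|} brCoeff · Λ'_S(c) = (k−2)! · (1 − N(c))` with `N(c) ≤ 1`;
* **`denseE_zero_eq_sum`**, **`denseE_zero_nonneg`** — `Ê(0) = (k−2)! Σ_c w^c (1 − N(c)) ≥ 0` for `w ≥ 0`:
  **THEOREM D: for every `k ≥ 2` and every family of increasing events, the leading coefficient of `E_k` at the dense end `p → 1`
  is nonnegative** (`sahiE_dpw_dense_end`).
HONEST FRAMING: the first coefficient at `p → 1` only; Sahi `C_k` for product measures / Kahn Conj. 5 / the master theorem remain open.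
[this work]
-/

namespace Summit.CriticalPhenomena.PercolationContinuityZ3.Theorems

namespace SahiSparseEnd

open Finset Function SahiComplement SahiRepresentativeForm
open Literature.Combinatorics.Sahi2008

variable {ι : Type*} [Fintype ι] [DecidableEq ι]

/-! ### Arithmetic -/

/-- `brCoeff s t · (s−2)! = (s−2+t)!` for `s ≥ 2`. [this work] -/
theorem brCoeff_mul_factorial {s : ℕ} (hs : 2 ≤ s) : ∀ t : ℕ,
    brCoeff s t * ((s - 2).factorial : ℝ) = ((s - 2 + t).factorial : ℝ)
  | 0 => by rw [brCoeff, prod_range_zero, one_mul, Nat.add_zero]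
  | t + 1 => by
    rw [brCoeff, prod_range_succ, ← brCoeff, mul_right_comm, brCoeff_mul_factorial hs t, ← Nat.add_assoc, Nat.factorial_succ]
    push_cast
    rw [Nat.cast_sub hs]
    push_cast
    ring

/-- `brCoeff s (k − s) · (s−1)! = (k−2)! · (s−1)` for `2 ≤ s ≤ k`. [this work] -/
theorem brCoeff_mul_factorial_pred {s k : ℕ} (hs : 2 ≤ s) (hsk : s ≤ k) :
    brCoeff s (k - s) * ((s - 1).factorial : ℝ) = ((k - 2).factorial : ℝ) * ((s : ℝ) - 1) := by
  have h1 : (s - 1).factorial = (s - 1) * (s - 2).factorial := by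
    rw [show s - 1 = (s - 2) + 1 by omega, Nat.factorial_succ]
  rw [h1, Nat.cast_mul, mul_left_comm, brCoeff_mul_factorial hs, show s - 2 + (k - s) = k - 2 by omega,
    Nat.cast_sub (by omega : 1 ≤ s)]
  push_cast
  ring

omit [Fintype ι] in
/-- `Σ_{S ⊆ T} (−1)^{|S|} = 0` for `T` nonempty (real version of Mathlib's). [folklore] -/
theorem sum_powerset_neg_one_pow_card_real {α : Type*} [DecidableEq α] {T : Finset α} (hT : T.Nonempty) :
    ∑ S ∈ T.powerset, (-1 : ℝ) ^ S.card = 0 := by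
  exact_mod_cast sum_powerset_neg_one_pow_card_of_nonempty hT

omit [Fintype ι] in
/-- `Σ_{S ⊆ T} (−1)^{|S|} · |S| = 0` for `|T| ≥ 2`. [folklore] -/
theorem sum_powerset_neg_one_pow_mul_card {α : Type*} [DecidableEq α] {T : Finset α} (hT : 2 ≤ T.card) :
    ∑ S ∈ T.powerset, (-1 : ℝ) ^ S.card * (S.card : ℝ) = 0 := by
  obtain ⟨x, hx⟩ : T.Nonempty := card_pos.1 (by omega)
  have hT' : (T.erase x).Nonempty := card_pos.1 (by rw [card_erase_of_mem hx]; omega)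
  rw [← insert_erase hx, sum_powerset_insert (notMem_erase x T)]
  have h : ∀ S ∈ (T.erase x).powerset, (-1 : ℝ) ^ (insert x S).card * ((insert x S).card : ℝ) =
      -((-1 : ℝ) ^ S.card * (S.card : ℝ)) - (-1 : ℝ) ^ S.card := by
    intro S hS
    have hxS : x ∉ S := fun h => notMem_erase x T (mem_powerset.1 hS h)
    rw [card_insert_of_notMem hxS, pow_succ]
    push_cast
    ring
  rw [sum_congr rfl h, sum_sub_distrib, sum_neg_distrib, sum_powerset_neg_one_pow_card_real hT']
  ring

omit [Fintype ι] in
/-- **`Σ_{S ⊆ T, |S| ≥ 2} (−1)^{|S|} (|S| − 1) = 1`** for `|T| ≥ 2`. [this work] -/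
theorem sum_powerset_neg_one_pow_mul_card_sub_one {α : Type*} [DecidableEq α] {T : Finset α} (hT : 2 ≤ T.card) :
    ∑ S ∈ T.powerset.filter (fun S => 2 ≤ S.card), (-1 : ℝ) ^ S.card * ((S.card : ℝ) - 1) = 1 := by
  have htot : ∑ S ∈ T.powerset, (-1 : ℝ) ^ S.card * ((S.card : ℝ) - 1) = 0 := by
    rw [show (fun S : Finset α => (-1 : ℝ) ^ S.card * ((S.card : ℝ) - 1)) =
        fun S => (-1 : ℝ) ^ S.card * (S.card : ℝ) - (-1 : ℝ) ^ S.card from funext fun S => by ring,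
      sum_sub_distrib, sum_powerset_neg_one_pow_mul_card hT, sum_powerset_neg_one_pow_card_real (card_pos.1 (by omega)),
      sub_zero]
  have hsmall : ∑ S ∈ T.powerset.filter (fun S => ¬ 2 ≤ S.card), (-1 : ℝ) ^ S.card * ((S.card : ℝ) - 1) = -1 := by
    have h : ∀ S ∈ T.powerset.filter (fun S => ¬ 2 ≤ S.card),
        (-1 : ℝ) ^ S.card * ((S.card : ℝ) - 1) = if S = ∅ then -1 else 0 := by
      intro S hS
      have hS2 := (mem_filter.1 hS).2
      by_cases hS0 : S = ∅
      · rw [if_pos hS0, hS0, card_empty]; norm_num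
      · have hc : S.card = 1 := by
          have := nonempty_iff_ne_empty.2 hS0 |>.card_pos; omega
        rw [if_neg hS0, hc]; norm_num
    rw [sum_congr rfl h, sum_ite_eq' (T.powerset.filter _) ∅ (fun _ => (-1 : ℝ)), if_pos]
    exact mem_filter.2 ⟨empty_mem_powerset T, by simp⟩
  have := sum_filter_add_sum_filter_not T.powerset (fun S => 2 ≤ S.card) (fun S => (-1 : ℝ) ^ S.card * ((S.card : ℝ) - 1))
  linarith

/-! ### The sparse end at `q = 0`, every arity -/

/-- The minimum common configurations, at every arity (`∅` at arity `0`). [this work] -/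
noncomputable def commonMin' : {s : ℕ} → (B : Fin s → Finset (Finset ι)) → (∀ i, (univ : Finset ι) ∈ B i) → Finset (Finset ι)
  | 0, _, _ => ∅
  | _ + 1, B, h => commonMin B (common_nonempty B h)

/-- Membership in `commonMin'` (positive arity). [this work] -/
theorem mem_commonMin' {s : ℕ} (hs : 1 ≤ s) (B : Fin s → Finset (Finset ι)) (h : ∀ i, (univ : Finset ι) ∈ B i) (c : Finset ι) :
    c ∈ commonMin' B h ↔ (∀ i, c ∈ B i) ∧ c.card = minSize' B h := by
  obtain ⟨n, rfl⟩ : ∃ n, s = n + 1 := ⟨s - 1, by omega⟩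
  show c ∈ commonMin B (common_nonempty B h) ↔ (∀ i, c ∈ B i) ∧ c.card = minSize B (common_nonempty B h)
  rw [commonMin, mem_filter, mem_common]

/-- `minSize' ≤ |a|` for every common configuration `a` (positive arity). [this work] -/
theorem minSize'_le {s : ℕ} (hs : 1 ≤ s) (B : Fin s → Finset (Finset ι)) (h : ∀ i, (univ : Finset ι) ∈ B i) {a : Finset ι}
    (ha : ∀ i, a ∈ B i) : minSize' B h ≤ a.card := by
  obtain ⟨n, rfl⟩ : ∃ n, s = n + 1 := ⟨s - 1, by omega⟩
  exact minSize_le B (h := common_nonempty B h) ((mem_common B).2 ha)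

/-- **`Ẽ(0) = Σ_{c ∈ commonMin'} w^c · Λ'(traces on c)`** at every arity. [this work] -/
theorem sparseE'_zero_eq (w : ι → ℝ) : ∀ {s : ℕ} (B : Fin s → Finset (Finset ι))
    (hB : ∀ i a a', a ∈ B i → a ⊆ a' → a' ∈ B i) (h0 : ∀ i, ∅ ∉ B i) (h : ∀ i, (univ : Finset ι) ∈ B i),
    sparseE' w B (minSize' B h) 0 =
      ∑ c ∈ commonMin' B h, (∏ e ∈ c, w e) * (LambdaSys (fun j => (B j).filter (· ⊆ c)) c : ℝ)
  | 0, _, _, _, _ => by simp [sparseE', commonMin']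
  | _ + 1, B, hB, h0, h => sparseE_zero_eq B hB h0 w _

/-! ### The per-configuration evaluation `Φ(c) = (k−2)! · (1 − N(c))` -/

section PerC

variable {k : ℕ} {A : Fin k → Finset (Finset ι)} (hA : ∀ i a a', a ∈ A i → a ⊆ a' → a' ∈ A i) (hA0 : ∀ i, ∅ ∉ A i)
  {hd : (doubly A).Nonempty} {c : Finset ι} (hc : c ∈ doubly A) (hcm : c.card = m2 A hd)

/-- The pairs-and-more of `T(c)`. [this work] -/
def P2 (A : Fin k → Finset (Finset ι)) (c : Finset ι) : Finset (Finset (Fin k)) := (Tc A c).powerset.filter fun S => 2 ≤ S.card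

/-- `N(c)`: the number of splits over the pairs of `T(c)`. [this work] -/
def Nc (A : Fin k → Finset (Finset ι)) (c : Finset ι) : ℕ := ∑ S ∈ (Tc A c).powersetCard 2, (ncSystems (traceFam A S c) c).card

include hc in
/-- `|T(c)| ≥ 2` for a doubly covered `c`. [this work] -/
theorem two_le_card_Tc : 2 ≤ (Tc A c).card := (mem_filter.1 hc).2

include hA hA0 hcm in
/-- `Λ'_S(c)` for `S ∈ P2(c)`: `(|S|−1)!` if `|S| ≥ 3`, `1 − n_S` if `|S| = 2`. [this work] -/
theorem lambdaSys_traceFam_eq {S : Finset (Fin k)} (hS : S ∈ P2 A c) :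
    (LambdaSys (traceFam A S c) c : ℝ) =
      if S.card = 2 then 1 - ((ncSystems (traceFam A S c) c).card : ℝ) else ((S.card - 1).factorial : ℝ) := by
  obtain ⟨hST, h2⟩ := mem_filter.1 hS
  have hST' : S ⊆ Tc A c := mem_powerset.1 hST
  split_ifs with h
  · rw [lambdaSys_two_eq (traceFam_top_mem hST') (traceFam_pairwise hcm S) h]; push_cast; ring
  · rw [lambdaSys_eq_factorial_of_three_le (traceFam_sub S) (traceFam_up hA S) (traceFam_empty_not_mem hA0 S)
      (traceFam_top_mem hST') (traceFam_pairwise hcm S) (by omega)]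
    push_cast; rfl

include hA hA0 hc hcm in
/-- **`Φ(c) = (k−2)! · (1 − N(c))`.** [this work] -/
theorem phi_eq : ∑ S ∈ P2 A c, (-1 : ℝ) ^ S.card * (brCoeff S.card (k - S.card) * (LambdaSys (traceFam A S c) c : ℝ)) =
    ((k - 2).factorial : ℝ) * (1 - (Nc A c : ℝ)) := by
  -- split each term into the "factorial part" and the "split correction"
  have hterm : ∀ S ∈ P2 A c, (-1 : ℝ) ^ S.card * (brCoeff S.card (k - S.card) * (LambdaSys (traceFam A S c) c : ℝ)) =
      ((k - 2).factorial : ℝ) * ((-1 : ℝ) ^ S.card * ((S.card : ℝ) - 1)) -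
        (if S.card = 2 then ((k - 2).factorial : ℝ) * ((ncSystems (traceFam A S c) c).card : ℝ) else 0) := by
    intro S hS
    obtain ⟨hST, h2⟩ := mem_filter.1 hS
    have hSk : S.card ≤ k := (card_le_univ S).trans (by rw [Fintype.card_fin])
    have hbr := brCoeff_mul_factorial_pred h2 hSk
    rw [lambdaSys_traceFam_eq hA hA0 hcm hS]
    split_ifs with h
    · generalize ((ncSystems (traceFam A S c) c).card : ℝ) = X
      rw [h] at hbr ⊢
      have hb2 : brCoeff 2 (k - 2) = ((k - 2).factorial : ℝ) := by
        have := hbr; norm_num at this; exact this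
      rw [hb2]; norm_num; ring
    · rw [hbr]; ring
  rw [sum_congr rfl hterm, sum_sub_distrib, ← mul_sum, ← sum_filter]
  rw [show (P2 A c).filter (fun S => S.card = 2) = (Tc A c).powersetCard 2 by
    ext S; rw [P2, filter_filter, powersetCard_eq_filter, mem_filter, mem_filter]
    constructor
    · rintro ⟨h, -, h2⟩; exact ⟨h, h2⟩
    · rintro ⟨h, h2⟩; exact ⟨h, by omega, h2⟩]
  rw [← mul_sum, P2, sum_powerset_neg_one_pow_mul_card_sub_one (two_le_card_Tc hc), Nc]
  push_cast
  ring

include hA hA0 hcm in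
/-- `Φ(c) ≥ 0`-ingredient: `N(c) ≤ 1`. [this work] -/
theorem Nc_le_one : Nc A c ≤ 1 := sum_card_ncSystems_le_one hA hA0 hcm

end PerC

/-! ### Regrouping `Ê(0)` by the cheapest double failures, and the sign -/

section Sign

open Filter Topology

variable {k : ℕ} (U : Fin k → Finset (Finset ι)) (hk : 2 ≤ k)
  (hU : ∀ i a a', a ∈ U i → a ⊆ a' → a' ∈ U i) (h0 : ∀ i, ∅ ∉ U i) (huniv : ∀ i, (univ : Finset ι) ∈ U i)

/-- The cheapest double-failure configurations `c` (`|c| = m₂`, `c` in at least two reflected failure events). [this work] -/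
noncomputable def Dmin (U : Fin k → Finset (Finset ι)) (hk : 2 ≤ k) (h0 : ∀ i, ∅ ∉ U i) : Finset (Finset ι) :=
  (doubly (reflFam U)).filter fun c => c.card = mTwo U hk h0

include hU in
/-- The reflected failure events are increasing. [this work] -/
theorem reflFam_up (i : Fin k) (a a' : Finset ι) (ha : a ∈ reflFam U i) (haa' : a ⊆ a') : a' ∈ reflFam U i :=
  reflA_up (hU i) a a' ha haa'

include huniv in
/-- `∅ ∉ A_i` (from `univ ∈ U_i`). [this work] -/
theorem empty_not_mem_reflFam (i : Fin k) : ∅ ∉ reflFam U i := empty_not_mem_reflA (huniv i)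

/-- The index swap behind the regrouping: `(S ∈ F₂ ∧ c ∈ commonMin'(A_S)) ↔ (S ∈ P2(c) ∧ c ∈ Dmin)`. [this work] -/
theorem swap_iff (S : Finset (Fin k)) (c : Finset ι) :
    (S ∈ ((univ : Finset (Fin k)).powerset).filter (fun S => 2 ≤ S.card ∧ mSub U h0 S = mTwo U hk h0) ∧
        c ∈ commonMin' (subFam (reflFam U) S) (fun _ => univ_mem_reflFam U h0 _)) ↔
      (S ∈ P2 (reflFam U) c ∧ c ∈ Dmin U hk h0) := by
  set A := reflFam U with hAdef
  have hAu : ∀ i, (univ : Finset ι) ∈ A i := univ_mem_reflFam U h0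
  constructor
  · rintro ⟨hS, hc⟩
    obtain ⟨-, h2, hm⟩ := mem_filter.1 hS
    obtain ⟨hall, hcard⟩ := (mem_commonMin' (by omega) _ _ c).1 hc
    have hST : S ⊆ Tc A c := by
      intro i hi
      have : i ∈ Set.range (S.orderEmbOfFin rfl) := by rw [range_orderEmbOfFin]; exact hi
      obtain ⟨j, rfl⟩ := this
      exact mem_Tc.2 (hall j)
    have hcm : c.card = mTwo U hk h0 := by rw [hcard]; exact hm
    refine ⟨mem_filter.2 ⟨mem_powerset.2 hST, h2⟩, mem_filter.2 ⟨mem_filter.2 ⟨mem_univ _, ?_⟩, hcm⟩⟩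
    exact h2.trans (card_le_card hST)
  · rintro ⟨hS, hc⟩
    obtain ⟨hST, h2⟩ := mem_filter.1 hS
    have hST' : S ⊆ Tc A c := mem_powerset.1 hST
    obtain ⟨hcd, hcm⟩ := mem_filter.1 hc
    have hall : ∀ j, c ∈ subFam A S j := fun j => (mem_Tc (A := A)).1 (hST' (orderEmbOfFin_mem S rfl j))
    have hle : mSub U h0 S ≤ c.card := minSize'_le (by omega) _ _ hall
    have hge : mTwo U hk h0 ≤ mSub U h0 S := m2_le_minSize'_subFam _ hAu h2
    have hm : mSub U h0 S = mTwo U hk h0 := by omega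
    refine ⟨mem_filter.2 ⟨mem_powerset.2 (subset_univ _), h2, hm⟩, (mem_commonMin' (by omega) _ _ c).2 ⟨hall, ?_⟩⟩
    show c.card = mSub U h0 S
    omega

include hU huniv in
/-- **`Ê(0) = (k−2)! · Σ_{c ∈ Dmin} w^c (1 − N(c))`.** [this work] -/
theorem denseE_zero_eq_sum (w : ι → ℝ) :
    denseE w U hk h0 0 = ((k - 2).factorial : ℝ) *
      ∑ c ∈ Dmin U hk h0, (∏ e ∈ c, w e) * (1 - (Nc (reflFam U) c : ℝ)) := by
  set A := reflFam U with hAdef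
  have hA : ∀ i a a', a ∈ A i → a ⊆ a' → a' ∈ A i := reflFam_up U hU
  have hA0 : ∀ i, ∅ ∉ A i := empty_not_mem_reflFam U huniv
  have hAu : ∀ i, (univ : Finset ι) ∈ A i := univ_mem_reflFam U h0
  rw [denseE_zero_eq]
  -- Step 1: evaluate each `Ẽ_S(0)`
  have h1 : ∀ S ∈ ((univ : Finset (Fin k)).powerset).filter (fun S => 2 ≤ S.card ∧ mSub U h0 S = mTwo U hk h0),
      (-1 : ℝ) ^ S.card * (brCoeff S.card (k - S.card) * sparseE' w (subFam A S) (mSub U h0 S) 0) =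
        ∑ c ∈ commonMin' (subFam A S) (fun _ => hAu _),
          (-1 : ℝ) ^ S.card * (brCoeff S.card (k - S.card) *
            ((∏ e ∈ c, w e) * (LambdaSys (fun j => (subFam A S j).filter (· ⊆ c)) c : ℝ))) := by
    intro S hS
    have e : sparseE' w (subFam A S) (mSub U h0 S) 0 =
        ∑ c ∈ commonMin' (subFam A S) (fun _ => hAu _),
          (∏ e ∈ c, w e) * (LambdaSys (fun j => (subFam A S j).filter (· ⊆ c)) c : ℝ) :=
      sparseE'_zero_eq w (subFam A S) (fun j => hA _) (fun j => hA0 _) (fun _ => hAu _)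
    rw [e, mul_sum, mul_sum]
  rw [sum_congr rfl h1, sum_comm' (swap_iff U hk h0)]
  -- Step 2: evaluate each group with `phi_eq`
  rw [mul_sum]
  refine sum_congr rfl fun c hc => ?_
  have hcm : c.card = m2 A (doubly_nonempty hk hAu) := (mem_filter.1 hc).2
  have hcd : c ∈ doubly A := (mem_filter.1 hc).1
  have hphi : ∑ S ∈ P2 A c, (-1 : ℝ) ^ S.card * (brCoeff S.card (k - S.card) *
      (LambdaSys (fun j => (subFam A S j).filter (· ⊆ c)) c : ℝ)) = ((k - 2).factorial : ℝ) * (1 - (Nc A c : ℝ)) :=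
    phi_eq hA hA0 hcd hcm
  have h2 : ∀ S ∈ P2 A c, (-1 : ℝ) ^ S.card * (brCoeff S.card (k - S.card) *
      ((∏ e ∈ c, w e) * (LambdaSys (fun j => (subFam A S j).filter (· ⊆ c)) c : ℝ))) =
        (∏ e ∈ c, w e) * ((-1 : ℝ) ^ S.card * (brCoeff S.card (k - S.card) *
          (LambdaSys (fun j => (subFam A S j).filter (· ⊆ c)) c : ℝ))) := fun S _ => by ring
  rw [sum_congr rfl h2, ← mul_sum, hphi]
  ring

include hU huniv in
/-- **THE SIGN: `Ê(0) ≥ 0`** for nonnegative intensities. [this work] -/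
theorem denseE_zero_nonneg {w : ι → ℝ} (hw : ∀ e, 0 ≤ w e) : 0 ≤ denseE w U hk h0 0 := by
  rw [denseE_zero_eq_sum U hk hU h0 huniv w]
  refine mul_nonneg (Nat.cast_nonneg _) (sum_nonneg fun c hc => mul_nonneg (prod_nonneg fun e _ => hw e) ?_)
  have hcm : c.card = m2 (reflFam U) (doubly_nonempty hk (univ_mem_reflFam U h0)) := (mem_filter.1 hc).2
  have h1 := Nc_le_one (reflFam_up U hU) (empty_not_mem_reflFam U huniv) hcm
  have : (Nc (reflFam U) c : ℝ) ≤ 1 := by exact_mod_cast h1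
  linarith

include hU huniv in
/-- **THEOREM D (the dense end of the master family, all orders `k ≥ 2`).**  For every family `U_0,…,U_{k−1}` of increasing events
of a finite cube (up-closed, `∅ ∉ U_i ∋ univ`) and nonnegative intensities `w`, under the product weight `dpw w q` with
`p_e = 1 − q·w_e`:  `E_k(1_U) = q^{m₂} · Ê(q)` for all real `q`, with `Ê` continuous,
`Ê(0) = (k−2)! · Σ_{c cheapest double failures} w^c (1 − N(c))` and **`Ê(0) ≥ 0`**: the leading coefficient of Sahi's functional at
the dense end `p → 1` is nonnegative, for every order. [this work] -/
theorem sahiE_dpw_dense_end {w : ι → ℝ} (hw : ∀ e, 0 ≤ w e) :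
    ∃ Et : ℝ → ℝ, Continuous Et ∧ (∀ q, sahiE (dpw w q) k (fun i => setInd (U i)) = q ^ mTwo U hk h0 * Et q) ∧
      Et 0 = ((k - 2).factorial : ℝ) * ∑ c ∈ Dmin U hk h0, (∏ e ∈ c, w e) * (1 - (Nc (reflFam U) c : ℝ)) ∧ 0 ≤ Et 0 :=
  ⟨denseE w U hk h0, continuous_denseE U hk h0 w, fun q => sahiE_dpw_eq_pow_mul U hk hU h0 w q,
    denseE_zero_eq_sum U hk hU h0 huniv w, denseE_zero_nonneg U hk hU h0 huniv hw⟩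

include hU in
/-- **Eventual positivity at the dense end**: if `Ê(0) > 0` then `E_k(dpw w q; 1_U) > 0` for all sufficiently small `q > 0`,
i.e. for all `p = 1 − q w` close enough to `1`. [this work] -/
theorem exists_pos_forall_sahiE_dpw_pos (w : ι → ℝ) (hpos : 0 < denseE w U hk h0 0) :
    ∃ δ > 0, ∀ q : ℝ, 0 < q → q < δ → 0 < sahiE (dpw w q) k (fun i => setInd (U i)) := by
  have hc : ContinuousAt (fun q : ℝ => denseE w U hk h0 q) 0 := (continuous_denseE U hk h0 w).continuousAt
  have hev : ∀ᶠ q in 𝓝 (0 : ℝ), 0 < denseE w U hk h0 q := hc.eventually (lt_mem_nhds hpos)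
  obtain ⟨δ, hδ, hball⟩ := Metric.eventually_nhds_iff.1 hev
  refine ⟨δ, hδ, fun q hq hqδ => ?_⟩
  have hq' : 0 < denseE w U hk h0 q := hball (by rw [Real.dist_eq, sub_zero, abs_of_pos hq]; exact hqδ)
  rw [sahiE_dpw_eq_pow_mul U hk hU h0 w q]
  exact mul_pos (pow_pos hq _) hq'

end Sign

end SahiSparseEnd

end Summit.CriticalPhenomena.PercolationContinuityZ3.Theorems
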